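import Mathlib
import Literature.Probability.LatticeModels.ProdBernoulliIndependence
import Literature.Probability.Percolation.SharpnessDCTProofs
import Literature.Probability.Percolation.PercolationProofs
import Summits.CriticalPhenomena.PercolationContinuityZ3.Theorems.PercNearOneGluingNearOneGluingExposureDecomp
import HarnessLib

/-!
# Crux `PercNearOneGluing.NearOneGluing` (stmt-CriticalPhenomena-4574), line `SketchR2I5`
# (finger–Laplace identity) — stub `stub_pocketLaplace` (pocket Laplace bound)

Helper file for the crux skeleton `Cruxes/NearOneGluing/Lines/SketchR2I5.lean`
(lead prover-line-stmt-CriticalPhenomena-4574-c1-0, wave 1).  Proves exactly the registered stub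
signature `stub_pocketLaplace`; lands with `--supports stmt-CriticalPhenomena-4574`.  The walk lemmas
about the relay-free pocket (`exposureDecomp_self_mem_pocket`, `exposureDecomp_pocket_disjoint`,
`exposureDecomp_pocket_step`, `exposureDecomp_pathIn_of_pocket_eq`,
`exposureDecomp_mem_openConn_of_attached`) are imported from
`PercNearOneGluingNearOneGluingExposureDecomp.lean`.

## Setting

Bond configurations `ω : Set (Sym2 (Fin n))` of the complete weighted graph on `Fin n` under
`μ = prodBernoulli w`; a relay set `A`, a source `o ∉ A`, a target `b`; an abstract POCKET SELECTOR
`P` with `v ∈ P ω ↔ ω ∈ openConnIn (↑A)ᶜ o v` (the relay-free pocket of `o`).  For a vertex set `T`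
and a relay `a`, `q_a(T) = ∏_{x ∈ T} (1 - w s(x, a))` is the probability that `a` is not attached to
`T` by an open pocket-to-relay pair, and `liveProd(T, ω) = ∏_{a ∈ A, a ↔ b off T} q_a(T)`
("live off `T`" = `ω ∈ openConnIn (↑T)ᶜ a b`).

## Statement (`stub_pocketLaplace`)

For `T ∌ b` and an event `D` determined by the pairs avoiding `T` (`{e | ∀ x ∈ T, x ∉ e}`):
`μ({o ↮ b} ∩ {P = T} ∩ D) ≤ μ{P = T} · ∫_D liveProd(T, ω) dμ`.

## Proof

* If `T` meets `A` then `{P = T} = ∅` (the pocket avoids `A`), and the right-hand side is `≥ 0`.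
* Otherwise partition by the value `L ⊆ A` of the live-relay set
  `liveF ω = {a ∈ A | a ↔ b off T}`.  On `{o ↮ b} ∩ {P = T}` every attachment pair `s(x, a)`,
  `x ∈ T`, `a` live, is CLOSED (an attached live relay joins `o` to `b`,
  `exposureDecomp_mem_openConn_of_attached`), so the `L`-piece lies in
  `({P = T} ∩ N_L) ∩ ({liveF = L} ∩ D)` with `N_L = {all pairs s(x, a), x ∈ T, a ∈ L, closed}`.
* Independence (`prodBernoulli_real_inter_of_determinedBy`, twice): `{P = T} ∩ N_L` is determined by
  the pairs meeting `T` (locality of the pocket, `pocketLaplace_pocket_eq_of_inter_eq`: the pocket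
  only reads pairs `s(x, y)` with `x ∈ T`, `y ∉ A`), `{liveF = L} ∩ D` by the pairs avoiding `T`
  (`DCT16.determinedBy_openConnIn` and the hypothesis on `D`); and `N_L` is determined by the
  attachment pairs while `{P = T}` is determined by their complement.  Hence
  `μ(piece_L) ≤ μ{P = T} · μ(N_L) · μ({liveF = L} ∩ D)` with
  `μ(N_L) = ∏_{a ∈ L} q_a(T)` (`prodBernoulli_real_forall_notMem`; the map `(a, x) ↦ s(x, a)` is
  injective on `L × T` because `T ∩ A = ∅`).
* Finally `Σ_L (∏_{a ∈ L} q_a(T)) · μ({liveF = L} ∩ D) = ∫_D liveProd(T, ω) dμ` because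
  `liveProd(T, ·)` is the simple function `Σ_L 1{liveF = L} ∏_{a ∈ L} q_a(T)`.
-/

namespace Summit.CriticalPhenomena.PercolationContinuityZ3.Theorems

open MeasureTheory Set Literature.Probability.LatticeModels Literature.Probability.Percolation
open scoped Classical BigOperators

section PocketLaplaceWalks

variable {n : ℕ} {A : Finset (Fin n)} {o b : Fin n} {P : Set (Sym2 (Fin n)) → Finset (Fin n)}

/-- **Locality of the relay-free pocket (sharp form).** If `ω, ω'` agree on a pair set `K`
containing every pair `s(x, y)` with `x ∈ T` and `y ∉ A`, and `P ω = T`, then `P ω' = T`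
(the pocket never reads a pocket-to-relay pair). -/
theorem pocketLaplace_pocket_eq_of_inter_eq
    (hP : ∀ ω v, v ∈ P ω ↔ ω ∈ openConnIn ((↑A : Set (Fin n))ᶜ) o v) (ho : o ∉ A)
    {K : Set (Sym2 (Fin n))} {T : Finset (Fin n)} (hK : ∀ x y, x ∈ T → y ∉ A → s(x, y) ∈ K)
    {ω ω' : Set (Sym2 (Fin n))} (h : ω ∩ K = ω' ∩ K) (hT : P ω = T) : P ω' = T := by
  have hoT : o ∈ T := hT ▸ exposureDecomp_self_mem_pocket hP ho ω
  have hTA : Disjoint T A := hT ▸ exposureDecomp_pocket_disjoint hP ω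
  have hK2 : (↑T : Set (Fin n)).sym2 ⊆ K := by
    intro e he
    revert he
    induction e using Sym2.ind with
    | _ x y =>
      intro he
      obtain ⟨hx, hy⟩ := Set.mk_mem_sym2_iff.1 he
      exact hK x y (Finset.mem_coe.1 hx)
        (fun hyA => Finset.disjoint_left.1 hTA (Finset.mem_coe.1 hy) hyA)
  ext v
  constructor
  · intro hv
    by_contra hvT
    have hp : PathIn (openGraph ω') ((↑A : Set (Fin n))ᶜ) o v :=
      DCT16.pathIn_of_mem_openConnIn ((hP ω' v).1 hv)
    obtain ⟨x, y, hx, hy, hyA, hxy, -⟩ := hp.exit (R := (↑T : Set (Fin n)))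
      (Finset.mem_coe.2 hoT) (fun h' => hvT (Finset.mem_coe.1 h'))
    rw [openGraph_adj] at hxy
    have hyA' : y ∉ A := fun h' => hyA (Finset.mem_coe.2 h')
    have heK : s(x, y) ∈ K := hK x y (Finset.mem_coe.1 hx) hyA'
    have heω : s(x, y) ∈ ω := (((Set.ext_iff.1 h) _).2 ⟨hxy.1, heK⟩).1
    have hxP : x ∈ P ω := by rw [hT]; exact Finset.mem_coe.1 hx
    have hyP : y ∈ P ω := exposureDecomp_pocket_step hP hxP heω hyA'
    rw [hT] at hyP
    exact hy (Finset.mem_coe.2 hyP)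
  · intro hvT
    have hp : PathIn (openGraph ω) (↑T : Set (Fin n)) o v :=
      exposureDecomp_pathIn_of_pocket_eq hP ho hT hvT
    have hp' : PathIn (openGraph ω') (↑T : Set (Fin n)) o v :=
      DCT16.pathIn_congr_of_inter_eq hK2 h hp
    refine (hP ω' v).2 (DCT16.mem_openConnIn_of_pathIn (hp'.mono fun u hu huA => ?_))
    exact Finset.disjoint_left.1 hTA (Finset.mem_coe.1 hu) (Finset.mem_coe.1 huA)

/-- `{P = T}` is determined by any pair set containing the pairs `s(x, y)`, `x ∈ T`, `y ∉ A`. -/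
theorem pocketLaplace_determinedBy_pocket_eq
    (hP : ∀ ω v, v ∈ P ω ↔ ω ∈ openConnIn ((↑A : Set (Fin n))ᶜ) o v) (ho : o ∉ A)
    {K : Set (Sym2 (Fin n))} (T : Finset (Fin n)) (hK : ∀ x y, x ∈ T → y ∉ A → s(x, y) ∈ K) :
    DeterminedBy {ω | P ω = T} K := by
  rw [determinedBy_iff]
  intro ω ω' h
  exact ⟨pocketLaplace_pocket_eq_of_inter_eq hP ho hK h,
    pocketLaplace_pocket_eq_of_inter_eq hP ho hK h.symm⟩

/-- The pairs avoiding `T` contain all pairs inside `(↑T)ᶜ`. -/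
theorem pocketLaplace_sym2_compl_subset_avoid (T : Finset (Fin n)) :
    ((↑T : Set (Fin n))ᶜ).sym2 ⊆ {e : Sym2 (Fin n) | ∀ x ∈ T, x ∉ e} := by
  intro e he
  induction e using Sym2.ind with
  | _ u v =>
    intro x hxT hxe
    rw [Set.mk_mem_sym2_iff] at he
    rcases Sym2.mem_iff.1 hxe with rfl | rfl
    · exact he.1 (Finset.mem_coe.2 hxT)
    · exact he.2 (Finset.mem_coe.2 hxT)

/-- The live-relay set off `T` (relays joined to `b` inside `(↑T)ᶜ`) is determined by the pairs
avoiding `T`. -/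
theorem pocketLaplace_liveFilter_eq_of_inter_eq (A T : Finset (Fin n)) (b : Fin n)
    {ω ω' : Set (Sym2 (Fin n))}
    (h : ω ∩ {e : Sym2 (Fin n) | ∀ x ∈ T, x ∉ e} = ω' ∩ {e : Sym2 (Fin n) | ∀ x ∈ T, x ∉ e}) :
    (A.filter fun a => ω ∈ openConnIn ((↑T : Set (Fin n))ᶜ) a b) =
      (A.filter fun a => ω' ∈ openConnIn ((↑T : Set (Fin n))ᶜ) a b) :=
  Finset.filter_congr fun a _ =>
    (determinedBy_iff _ _).1
      (DCT16.determinedBy_openConnIn ((↑T : Set (Fin n))ᶜ) a b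
        (pocketLaplace_sym2_compl_subset_avoid T)) ω ω' h

/-- A cylinder event "all pairs of `G` are closed" is determined by `↑G`. -/
theorem pocketLaplace_determinedBy_forall_notMem (G : Finset (Sym2 (Fin n))) :
    DeterminedBy {ω : Set (Sym2 (Fin n)) | ∀ e ∈ G, e ∉ ω} (↑G : Set (Sym2 (Fin n))) := by
  rw [determinedBy_iff]
  intro ω ω' h
  simp only [mem_setOf_eq]
  refine forall₂_congr fun e he => not_congr ?_
  have heG : e ∈ (↑G : Set (Sym2 (Fin n))) := Finset.mem_coe.2 he
  exact ⟨fun h1 => (((Set.ext_iff.1 h) _).1 ⟨h1, heG⟩).1,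
    fun h1 => (((Set.ext_iff.1 h) _).2 ⟨h1, heG⟩).1⟩

/-- `q`-products are nonnegative. -/
theorem pocketLaplace_prod_prod_nonneg (w : Sym2 (Fin n) → unitInterval) (B T : Finset (Fin n)) :
    0 ≤ ∏ a ∈ B, ∏ x ∈ T, (1 - (w s(x, a) : ℝ)) :=
  Finset.prod_nonneg fun a _ => Finset.prod_nonneg fun x _ => sub_nonneg.2 (w s(x, a)).2.2

/-- The attachment cylinder has probability `∏_{a ∈ L} ∏_{x ∈ T} (1 - w s(x, a))` when `T` avoids
`A ⊇ L` (then `(a, x) ↦ s(x, a)` is injective on `L × T`). -/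
theorem pocketLaplace_real_attach_closed (w : Sym2 (Fin n) → unitInterval) {A T L : Finset (Fin n)}
    (hTA : Disjoint T A) (hL : L ⊆ A) :
    (prodBernoulli w).real {ω : Set (Sym2 (Fin n)) |
        ∀ e ∈ (L ×ˢ T).image (fun p : Fin n × Fin n => s(p.2, p.1)), e ∉ ω} =
      ∏ a ∈ L, ∏ x ∈ T, (1 - (w s(x, a) : ℝ)) := by
  rw [prodBernoulli_real_forall_notMem, Finset.prod_image, Finset.prod_product]
  rintro ⟨a, x⟩ hp ⟨a', x'⟩ hp' he
  obtain ⟨-, hxT⟩ := Finset.mem_product.1 (Finset.mem_coe.1 hp)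
  obtain ⟨ha'L, -⟩ := Finset.mem_product.1 (Finset.mem_coe.1 hp')
  have he' : s(x, a) = s(x', a') := he
  rcases Sym2.eq_iff.1 he' with ⟨hx, ha⟩ | ⟨hx, -⟩
  · exact Prod.ext ha hx
  · exact absurd (hL ha'L) (Finset.disjoint_left.1 hTA (hx ▸ hxT))

end PocketLaplaceWalks

section PocketLaplaceMain

variable {n : ℕ}

/-- **The set integral of the live product as a finite sum over the live-relay set.** -/
theorem pocketLaplace_setIntegral_liveProd (w : Sym2 (Fin n) → unitInterval) (A T : Finset (Fin n))
    (b : Fin n) (D : Set (Set (Sym2 (Fin n)))) :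
    ∫ ω in D, (∏ a ∈ A.filter (fun a => ω ∈ openConnIn ((↑T : Set (Fin n))ᶜ) a b),
        ∏ x ∈ T, (1 - (w s(x, a) : ℝ))) ∂(prodBernoulli w) =
      ∑ L ∈ A.powerset, (∏ a ∈ L, ∏ x ∈ T, (1 - (w s(x, a) : ℝ))) *
        (prodBernoulli w).real
          ({ω | (A.filter fun a => ω ∈ openConnIn ((↑T : Set (Fin n))ᶜ) a b) = L} ∩ D) := by
  set μ := prodBernoulli w with hμ
  set liveF : Set (Sym2 (Fin n)) → Finset (Fin n) :=
    fun ω => A.filter fun a => ω ∈ openConnIn ((↑T : Set (Fin n))ᶜ) a b with hliveF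
  set c : Finset (Fin n) → ℝ := fun L => ∏ a ∈ L, ∏ x ∈ T, (1 - (w s(x, a) : ℝ)) with hc
  have hpt : ∀ ω, c (liveF ω) =
      ∑ L ∈ A.powerset, ({ω' | liveF ω' = L} : Set (Set (Sym2 (Fin n)))).indicator
        (fun _ => c L) ω := by
    intro ω
    rw [Finset.sum_eq_single (liveF ω)]
    · rw [indicator_of_mem (show ω ∈ {ω' | liveF ω' = liveF ω} from rfl)]
    · intro L _ hne
      exact indicator_of_notMem (fun h : liveF ω = L => hne h.symm) _
    · intro h
      exact absurd (Finset.mem_powerset.2 (Finset.filter_subset _ _)) h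
  change ∫ ω in D, c (liveF ω) ∂μ = ∑ L ∈ A.powerset, c L * μ.real ({ω | liveF ω = L} ∩ D)
  simp_rw [hpt]
  rw [integral_finsetSum _ fun L _ => Integrable.of_finite]
  refine Finset.sum_congr rfl fun L _ => ?_
  rw [integral_indicator_const (c L) MeasurableSet.of_discrete, smul_eq_mul,
    measureReal_restrict_apply MeasurableSet.of_discrete, mul_comm]

/-- **Stub `stub_pocketLaplace` of the line `SketchR2I5` (pocket Laplace bound).** Let `P` be the
relay-free pocket selector (`v ∈ P ω ↔ o ↔ v` inside `(↑A)ᶜ`), `o ∉ A`, `T ∌ b` a vertex set and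
`D` an event determined by the pairs avoiding `T`.  Then
`μ({o ↮ b} ∩ {P = T} ∩ D) ≤ μ{P = T} · ∫_D ∏_{a ∈ A, a ↔ b off T} ∏_{x ∈ T} (1 - w s(x, a)) dμ`.
Proof: partition by the live-relay set `L`; on `{o ↮ b} ∩ {P = T}` all attachment pairs to live
relays are closed; the pocket event, the attachment cylinder and the outside event
`{liveF = L} ∩ D` are determined by pairwise disjoint pair families, so the measure factorises,
and the attachment cylinder has probability `∏_{a ∈ L} ∏_{x ∈ T} (1 - w s(x, a))`. -/
theorem stub_pocketLaplace :
    ∀ (n : ℕ) (w : Sym2 (Fin n) → unitInterval) (A : Finset (Fin n)) (o b : Fin n), o ∉ A →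
      ∀ (P : Set (Sym2 (Fin n)) → Finset (Fin n)),
        (∀ ω v, v ∈ P ω ↔ ω ∈ openConnIn ((↑A : Set (Fin n))ᶜ) o v) →
      ∀ (T : Finset (Fin n)), b ∉ T →
      ∀ (D : Set (Set (Sym2 (Fin n)))), DeterminedBy D {e | ∀ x ∈ T, x ∉ e} →
        (prodBernoulli w).real ({ω | ω ∉ openConn o b ∧ P ω = T} ∩ D) ≤
          (prodBernoulli w).real {ω | P ω = T} *
            ∫ ω in D, (∏ a ∈ A.filter (fun a => ω ∈ openConnIn ((↑T : Set (Fin n))ᶜ) a b),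
                ∏ x ∈ T, (1 - (w s(x, a) : ℝ))) ∂(prodBernoulli w) := by
  intro n w A o b ho P hP T hbT D hD
  rw [pocketLaplace_setIntegral_liveProd]
  set μ := prodBernoulli w with hμ
  -- notation
  set liveF : Set (Sym2 (Fin n)) → Finset (Fin n) :=
    fun ω => A.filter fun a => ω ∈ openConnIn ((↑T : Set (Fin n))ᶜ) a b with hliveF
  set c : Finset (Fin n) → ℝ := fun L => ∏ a ∈ L, ∏ x ∈ T, (1 - (w s(x, a) : ℝ)) with hc
  set S : Set (Set (Sym2 (Fin n))) := {ω | ω ∉ openConn o b ∧ P ω = T} ∩ D with hS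
  have hc_nn : ∀ L, 0 ≤ c L := fun L => pocketLaplace_prod_prod_nonneg w L T
  change μ.real S ≤ μ.real {ω | P ω = T} * ∑ L ∈ A.powerset, c L * μ.real ({ω | liveF ω = L} ∩ D)
  -- degenerate case: the pocket value meets `A`
  by_cases hTA : Disjoint T A
  swap
  · have hempty : S = ∅ := Set.eq_empty_of_forall_notMem fun ω hω =>
      hTA (hω.1.2 ▸ exposureDecomp_pocket_disjoint hP ω)
    rw [hempty, measureReal_empty]
    exact mul_nonneg measureReal_nonneg
      (Finset.sum_nonneg fun L _ => mul_nonneg (hc_nn L) measureReal_nonneg)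
  -- the attachment cylinders and the pieces
  set G : Finset (Fin n) → Finset (Sym2 (Fin n)) :=
    fun L => (L ×ˢ T).image (fun p : Fin n × Fin n => s(p.2, p.1)) with hG
  set N : Finset (Fin n) → Set (Set (Sym2 (Fin n))) := fun L => {ω | ∀ e ∈ G L, e ∉ ω} with hN
  set C : Finset (Fin n) → Set (Set (Sym2 (Fin n))) := fun L => {ω | liveF ω = L} ∩ D with hC
  -- the pairs meeting `T`
  set F₁ : Finset (Sym2 (Fin n)) := Finset.univ.filter fun e : Sym2 (Fin n) => ∃ x ∈ T, x ∈ e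
    with hF₁
  have hF₁mem : ∀ x y, x ∈ T → s(x, y) ∈ (↑F₁ : Set (Sym2 (Fin n))) := fun x y hx => by
    rw [hF₁, Finset.coe_filter]
    exact ⟨Finset.mem_univ _, x, hx, Sym2.mem_mk_left x y⟩
  have hF₁c : {e : Sym2 (Fin n) | ∀ x ∈ T, x ∉ e} ⊆ (↑F₁ : Set (Sym2 (Fin n)))ᶜ := by
    intro e he heF
    rw [hF₁, Finset.coe_filter] at heF
    obtain ⟨-, x, hx, hxe⟩ := heF
    exact he x hx hxe
  -- covering
  have hcover : S ⊆ ⋃ L ∈ A.powerset, (({ω | P ω = T} ∩ N L) ∩ C L) := by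
    rintro ω ⟨⟨hob, hPT⟩, hωD⟩
    simp only [mem_iUnion, exists_prop]
    refine ⟨liveF ω, Finset.mem_powerset.2 (Finset.filter_subset _ _), ⟨hPT, ?_⟩, rfl, hωD⟩
    intro e he heω
    rw [hG, Finset.mem_image] at he
    obtain ⟨⟨a, x⟩, hp, rfl⟩ := he
    rw [Finset.mem_product] at hp
    obtain ⟨ha, hx⟩ := hp
    rw [hliveF, Finset.mem_filter] at ha
    have hxP : x ∈ P ω := hPT ▸ hx
    exact hob (exposureDecomp_mem_openConn_of_attached hP hxP heω ha.1 ha.2)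
  -- the per-piece factorisation
  have hpiece : ∀ L ∈ A.powerset,
      μ.real (({ω | P ω = T} ∩ N L) ∩ C L) = μ.real {ω | P ω = T} * (c L * μ.real (C L)) := by
    intro L hL
    rw [Finset.mem_powerset] at hL
    -- `{P = T} ∩ N_L` is determined by the pairs meeting `T`, `C_L` by the pairs avoiding `T`
    have hdet1 : DeterminedBy ({ω | P ω = T} ∩ N L) (↑F₁ : Set (Sym2 (Fin n))) :=
      (pocketLaplace_determinedBy_pocket_eq hP ho T fun x y hx _ => hF₁mem x y hx).inter
        ((pocketLaplace_determinedBy_forall_notMem (G L)).mono fun e he => by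
          rw [Finset.mem_coe, hG, Finset.mem_image] at he
          obtain ⟨⟨a, x⟩, hp, rfl⟩ := he
          exact hF₁mem x a (Finset.mem_product.1 hp).2)
    have hdet2 : DeterminedBy (C L) (↑F₁ : Set (Sym2 (Fin n)))ᶜ := by
      refine DeterminedBy.inter ?_ (hD.mono hF₁c)
      refine DeterminedBy.mono ?_ hF₁c
      rw [determinedBy_iff]
      intro ω ω' h
      simp only [mem_setOf_eq]
      rw [show liveF ω = liveF ω' from pocketLaplace_liveFilter_eq_of_inter_eq A T b h]
    have hind1 : μ.real (({ω | P ω = T} ∩ N L) ∩ C L) =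
        μ.real ({ω | P ω = T} ∩ N L) * μ.real (C L) :=
      prodBernoulli_real_inter_of_determinedBy w F₁ hdet1 hdet2
        MeasurableSet.of_discrete MeasurableSet.of_discrete
    -- `N_L` is determined by the attachment pairs, `{P = T}` by their complement
    have hdet3 : DeterminedBy {ω | P ω = T} (↑(G L) : Set (Sym2 (Fin n)))ᶜ := by
      refine pocketLaplace_determinedBy_pocket_eq hP ho T fun x y hx hyA he => ?_
      rw [Finset.mem_coe, hG, Finset.mem_image] at he
      obtain ⟨⟨a', x'⟩, hp, he⟩ := he
      obtain ⟨ha'L, -⟩ := Finset.mem_product.1 hp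
      have ha'A : a' ∈ A := hL ha'L
      have he' : s(x', a') = s(x, y) := he
      rcases Sym2.eq_iff.1 he' with ⟨-, ha⟩ | ⟨-, ha⟩
      · exact hyA (ha ▸ ha'A)
      · exact Finset.disjoint_left.1 hTA hx (ha ▸ ha'A)
    have hind2 : μ.real ({ω | P ω = T} ∩ N L) = μ.real {ω | P ω = T} * μ.real (N L) := by
      rw [Set.inter_comm, prodBernoulli_real_inter_of_determinedBy w (G L)
        (pocketLaplace_determinedBy_forall_notMem (G L)) hdet3
        MeasurableSet.of_discrete MeasurableSet.of_discrete, mul_comm]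
    have hNL : μ.real (N L) = c L := pocketLaplace_real_attach_closed w hTA hL
    rw [hind1, hind2, hNL, mul_assoc]
  -- assembly
  calc μ.real S
      ≤ μ.real (⋃ L ∈ A.powerset, (({ω | P ω = T} ∩ N L) ∩ C L)) :=
        measureReal_mono hcover (measure_ne_top _ _)
    _ ≤ ∑ L ∈ A.powerset, μ.real (({ω | P ω = T} ∩ N L) ∩ C L) :=
        measureReal_biUnion_finset_le _ _
    _ = ∑ L ∈ A.powerset, μ.real {ω | P ω = T} * (c L * μ.real (C L)) :=
        Finset.sum_congr rfl hpiece
    _ = μ.real {ω | P ω = T} * ∑ L ∈ A.powerset, c L * μ.real ({ω | liveF ω = L} ∩ D) := by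
        rw [Finset.mul_sum]

end PocketLaplaceMain

end Summit.CriticalPhenomena.PercolationContinuityZ3.Theorems
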